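import Summits.CriticalPhenomena.PercolationContinuityZ3.Theorems.Transplant.FluoriteSkeletonConc
import Summits.CriticalPhenomena.PercolationContinuityZ3.Theorems.Transplant.SkelConcHolds
import HarnessLib

/-!
# The FLUORITE net at its own critical point — UNCONDITIONAL: `θ_{flu}(v, p_c(flu)) = 0` at every vertex (cations and anions) and a.s. no
# infinite cluster at `p_c(flu)`

builds on p205010 (kernel theorem, internal audit signed; external expert review pending).
Status sentence (coordinator 2026-08-20T04:30Z): "θ(p_c) = 0 on ℤ^d, all d ≥ 2 — kernel-verified (Lean 4/Mathlib,
standard axioms); internal adversarial audit SIGNED 2026-08-20 04:29Z; external expert review pending."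

Lane `prim-bschramm-*`, seat `prim-bschramm-p2` (gen 6).  One-liners: the reductions of `FluoriteSkeletonConc.lean` composed with the lane's general
node `samePDropOfSkeletonConcLt_holds` (`SkelConcHolds.lean`, (Z'); builds on p205010).  The fluorite net (`CaF₂`; cations 8-coordinated, anions
4-coordinated; quasi-transitive, NOT vertex-transitive) is the lane's first binodal 3D net: bond percolation on it has no infinite cluster at its own
critical point.  Not in print. [cite: BenjaminiSchramm1996, Conj. 4] [cite: KozmaNitzan2024, §1 p. 2 (approach 1), §4]
-/

noncomputable section

namespace Summit.CriticalPhenomena.PercolationContinuityZ3.Theorems.Transplant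

open MeasureTheory Literature.Probability.Percolation Literature.Probability.LatticeModels

/-- **THEOREM: bond percolation on the fluorite net dies at its own critical point** (at the cation origin) — builds on p205010 (kernel theorem,
internal audit signed; external expert review pending). [cite: BenjaminiSchramm1996, Conj. 4] -/
theorem fluOwnCriticalContinuity_holds : FluoriteOwnCriticalContinuity :=
  fluOwnCriticalContinuity_of_skeletonConcNode samePDropOfSkeletonConcLt_holds

/-- … at EVERY vertex of the fluorite net, cations and anions alike. [cite: BenjaminiSchramm1996, Conj. 4] -/
theorem flu_criticalContinuity_holds (v : fluSite) : theta fluGraph v (criticalProbIOf fluGraph v) = 0 :=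
  flu_criticalContinuity_of_skeletonConcNode samePDropOfSkeletonConcLt_holds v

/-- **At `p_c(flu)` there is almost surely no infinite cluster anywhere in the fluorite net.** [cite: BenjaminiSchramm1996, Conj. 4] -/
theorem flu_noInfiniteCluster_at_ownCriticalProb :
    (bondPercolation fluGraph (criticalProbIOf fluGraph fluOrigin)).real {ω | ∃ y : fluSite, ω ∈ percolatesAt y} = 0 :=
  flu_noInfiniteCluster_of_skeletonConcNode samePDropOfSkeletonConcLt_holds

end Summit.CriticalPhenomena.PercolationContinuityZ3.Theorems.Transplant

end
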